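import Literature.InformationTheory.QuantumCodes.QuantumMacWilliams
import Literature.Computability.QuantumComplexity.DecisionDiagrams
import HarnessLib

/-!
# The quantum Hamming bound for pure codes of arbitrary structure — proof

Topic `Literature/InformationTheory/QuantumCodes` (venture QEC, cell `qec`, PARTITION v2 row 06 / D2.6, rung X1
«pure-Hamming column»). The tree's `quantumHammingBound(_holds)` (`SymplecticCodes.lean`, qec-lit-1) is the
sphere-packing bound for pure ADDITIVE (stabilizer) codes. This file PROVES the same bound for every PURE
`((n,K,d))` qubit code carried by its orthogonal projection `P` (`IsCodeProjection P K d`, `IsPureToWeight P d` of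
`WeightEnumeratorBounds.lean`), i.e. the special case «pure» of the printed statement «a nondegenerate
`((n,K,d))_q` quantum code satisfies the Hamming bound `K ≤ qⁿ / Σ_{j=0}^{⌊(d−1)/2⌋} C(n,j)(q²−1)^j`» for `q = 2`
[SarvepalliKlappenecker2010, §1 eq. (2); attributed there to Ekert–Macchiavello and Gottesman 1996] — a pure code
(`Tr(EP) = 0` for `0 < wt E < d`) is nondegenerate in the sense of [SarvepalliKlappenecker2010, §1] (its matrix
`C = (Tr(P E†F P)/K)_{E,F}` on the errors of weight `≤ t` is the identity).
-- TODO(general form): nondegenerate codes in the sense «the Knill–Laflamme matrix `C` on `ℰ_t` is nonsingular»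
-- [SarvepalliKlappenecker2010, §1 eq. (1)–(2)], and qudit alphabets `q > 2`.

Proof («the standard proof of (2) by a simple counting argument»): with `t = ⌊(d−1)/2⌋` and `ℬ_t` the Pauli words
of weight `≤ t` (`|ℬ_t| = Σ_{j ≤ t} 3^j C(n,j)`, §1), the operators `E P E`, `E ∈ ℬ_t`, are projections with
pairwise products `E (P·EF·P) F = 0` (`EF` is, up to a phase, a word of weight `0 < wt ≤ 2t < d`, killed by purity +
Knill–Laflamme), so `Q = Σ_{E ∈ ℬ_t} E P E` is a projection and `K |ℬ_t| = Tr Q ≤ 2ⁿ` (§2).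

All theorems: column proved; no named facts, no `sorry`. Definitions introduced (proof vocabulary): `ballWords`.

## Mathlib / tree search

Tree: `wordsOfWt`, `mem_wordsOfWt`, `wordSign`, `letterSign`, `sum_wordSign_eq_krawtchouk4` (QuantumMacWilliams, this
seat — the count `|{wt = j}| = P_j(0,n) = 3^j C(n,j)` is its value at the identity word); `Pauli.letterMul`,
`stringMul`, `stringPhase`, `pauliString_mul` (QuantumComplexity/DecisionDiagrams); `pauliString_mul_self`,
`conjTranspose_pauliString`, `pauliCoeff` (PauliParseval/PauliExpansion); `IsCodeProjection`, `IsPureToWeight`,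
`DetectsWeightLE`, `pauliWt`, `krawtchouk4` (WeightEnumeratorBounds, qec-type-06); additive version
`quantumHammingBound_holds` (SymplecticCodes, qec-lit-1) — different carrier, not restated.
Mathlib: `Matrix.trace_conjTranspose_mul_self_eq_zero_iff`, `Matrix.PosSemidef.trace_nonneg` (`ComplexOrder`).
-/

noncomputable section

open Finset Matrix
open Literature.Computability.QuantumComplexity

namespace Literature.InformationTheory.QuantumCodes

variable {ι : Type*} [Fintype ι] [DecidableEq ι]

/-! ### §1. Counting Pauli words; products of words -/

omit [DecidableEq ι] in
/-- Every word commutes with the identity word: `(−1)^{⟨S, I⟩} = 1`. [cite: Rains1999Shadow, §1 p. 2361 («(−1)^{⟨E₁,E₂⟩} = E₁E₂E₁E₂»)] -/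
theorem wordSign_constI (S : ι → Pauli) : wordSign S (fun _ => Pauli.I) = 1 :=
  Finset.prod_eq_one fun i _ => by simp [letterSign]

/-- `P_j(0,n) = 3^j C(n,j)`. [cite: Rains1999Shadow, Thm. 10 p. 2364 (definition of P_j(x,n))] -/
theorem krawtchouk4_at_zero (n j : ℕ) : krawtchouk4 n j 0 = 3 ^ j * (n.choose j : ℤ) := by
  rw [krawtchouk4, Finset.sum_range_succ']
  simp [Nat.choose_zero_succ]

/-- **The number of Pauli words of weight `j` on `n` qubits is `3^j C(n,j)`** (the `j`-th term of the Hamming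
ball count `Σ_j C(n,j)(q²−1)^j`, `q = 2`). [cite: SarvepalliKlappenecker2010, §1 eq. (2) (denominator)] -/
theorem card_wordsOfWt (j : ℕ) : #(wordsOfWt ι j) = 3 ^ j * (Fintype.card ι).choose j := by
  have h := sum_wordSign_eq_krawtchouk4 j (fun _ : ι => Pauli.I)
  simp only [wordSign_constI, Finset.sum_const, nsmul_eq_mul, mul_one] at h
  have h0 : pauliWt (fun _ : ι => Pauli.I) = 0 := by simp [pauliWt]
  rw [h0, krawtchouk4_at_zero] at h
  exact_mod_cast h

/-- The Pauli words of weight at most `t` (the error set `ℰ_t` spanning «all elements affecting at most `t` quantum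
systems», restricted to tensor products of Pauli matrices). [cite: SarvepalliKlappenecker2010, §1 (ℰ_t)] -/
def ballWords (ι : Type*) [Fintype ι] [DecidableEq ι] (t : ℕ) : Finset (ι → Pauli) :=
  univ.filter fun S => pauliWt S ≤ t

/-- Membership in `ballWords`. [cite: SarvepalliKlappenecker2010, §1 (ℰ_t)] -/
@[simp] theorem mem_ballWords {t : ℕ} {S : ι → Pauli} : S ∈ ballWords ι t ↔ pauliWt S ≤ t := by
  simp [ballWords]

/-- **Size of the Hamming ball**: `|ℰ_t ∩ Pauli words| = Σ_{j=0}^{t} 3^j C(n,j)`.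
[cite: SarvepalliKlappenecker2010, §1 eq. (2) (denominator Σ_{j=0}^{⌊(d−1)/2⌋} C(n,j)(q²−1)^j)] -/
theorem card_ballWords (t : ℕ) :
    #(ballWords ι t) = ∑ j ∈ range (t + 1), 3 ^ j * (Fintype.card ι).choose j := by
  have h : ballWords ι t = (range (t + 1)).biUnion (wordsOfWt ι) := by
    ext S
    simp only [mem_ballWords, Finset.mem_biUnion, Finset.mem_range, mem_wordsOfWt, Nat.lt_succ_iff]
    constructor
    · intro hS; exact ⟨pauliWt S, hS, rfl⟩
    · rintro ⟨j, hj, hS⟩; rw [hS]; exact hj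
  rw [h, Finset.card_biUnion]
  · exact Finset.sum_congr rfl fun j _ => card_wordsOfWt j
  · intro j _ j' _ hjj'
    exact Finset.disjoint_left.2 fun S hS hS' => hjj' ((mem_wordsOfWt.1 hS).symm.trans (mem_wordsOfWt.1 hS'))

/-- The letter product is the identity exactly on the diagonal: `Q·P = I ↔ Q = P`. [folklore] -/
private theorem letterMul_eq_I_iff (Q P : Pauli) : Pauli.letterMul Q P = Pauli.I ↔ Q = P := by
  cases Q <;> cases P <;> simp [Pauli.letterMul]

/-- A non-identity letter of a product comes from a non-identity factor. [folklore] -/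
private theorem letterMul_ne_I {Q P : Pauli} (h : Pauli.letterMul Q P ≠ Pauli.I) : Q ≠ Pauli.I ∨ P ≠ Pauli.I := by
  cases Q <;> cases P <;> simp_all [Pauli.letterMul]

/-- **Weight of a product of words**: `wt(E·F) ≤ wt(E) + wt(F)` (the support of `EF` lies in `supp E ∪ supp F`).
[cite: SarvepalliKlappenecker2010, §1 («detect all errors in the set {E†F | E, F ∈ B}»)] -/
theorem pauliWt_stringMul_le (E F : ι → Pauli) : pauliWt (stringMul E F) ≤ pauliWt E + pauliWt F := by
  unfold pauliWt
  calc #(univ.filter fun i => stringMul E F i ≠ Pauli.I)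
      ≤ #((univ.filter fun i => E i ≠ Pauli.I) ∪ (univ.filter fun i => F i ≠ Pauli.I)) := by
        refine Finset.card_le_card fun i hi => ?_
        rw [Finset.mem_filter] at hi
        rw [Finset.mem_union, Finset.mem_filter, Finset.mem_filter]
        rcases letterMul_ne_I hi.2 with h | h
        · exact Or.inl ⟨Finset.mem_univ _, h⟩
        · exact Or.inr ⟨Finset.mem_univ _, h⟩
    _ ≤ #(univ.filter fun i => E i ≠ Pauli.I) + #(univ.filter fun i => F i ≠ Pauli.I) :=
        Finset.card_union_le _ _

omit [DecidableEq ι] in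
/-- Distinct words have a non-identity product: `E ≠ F → wt(E·F) > 0`. [cite: SarvepalliKlappenecker2010, §1 (the error set {E†F})] -/
theorem pauliWt_stringMul_pos {E F : ι → Pauli} (h : E ≠ F) : 0 < pauliWt (stringMul E F) := by
  unfold pauliWt
  rw [Finset.card_pos]
  by_contra hc
  rw [Finset.not_nonempty_iff_eq_empty, Finset.filter_eq_empty_iff] at hc
  exact h (funext fun i => (letterMul_eq_I_iff (E i) (F i)).1 (not_not.1 (hc (Finset.mem_univ i))))

/-! ### §2. The packing argument -/

open scoped ComplexOrder

/-- **Orthogonality of the translates `E𝒞`, `F𝒞`**: for a pure `((n,K,d))` with projection `P` and Pauli words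
`E ≠ F` of weight `≤ t`, `2t < d`, the compression `P (E F) P` vanishes — `EF` is a phase times a word of weight
`0 < wt ≤ 2t < d`, whose compression is `c·P` (Knill–Laflamme) with `cK = Tr(EF·P) = 0` (purity).
[cite: SarvepalliKlappenecker2010, §1 eq. (1)–(2) (nondegenerate: the matrix C is nonsingular — here C = 1)] -/
theorem compress_mul_eq_zero {K d t : ℕ} {P : Matrix (ι → Bool) (ι → Bool) ℂ} (hP : IsCodeProjection P K d)
    (hpure : IsPureToWeight P d) (htd : 2 * t < d) {E F : ι → Pauli} (hE : pauliWt E ≤ t) (hF : pauliWt F ≤ t)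
    (hEF : E ≠ F) : P * (pauliString E * pauliString F) * P = 0 := by
  obtain ⟨hH, hPP, htr, hdet⟩ := hP
  have hwt : pauliWt (stringMul E F) ≤ 2 * t := (pauliWt_stringMul_le E F).trans (by omega)
  obtain ⟨c, hc⟩ := hdet (stringMul E F) (by omega)
  -- `c K = Tr(P G P) = Tr(G P) = 0`
  have hcK : c * K = 0 := by
    have h1 : (P * pauliString (stringMul E F) * P).trace = c * K := by
      rw [hc, Matrix.trace_smul, htr, smul_eq_mul]
    have h2 : (P * pauliString (stringMul E F) * P).trace = 0 := by
      rw [Matrix.mul_assoc, Matrix.trace_mul_comm, Matrix.mul_assoc, hPP]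
      exact hpure _ (pauliWt_stringMul_pos hEF) (by omega)
    rw [← h1, h2]
  rcases Nat.eq_zero_or_pos K with hK0 | hKpos
  · -- `K = 0`: `P = 0`
    subst hK0
    have hP0 : P = 0 := by
      have h : (Pᴴ * P).trace = 0 := by rw [hH.eq, hPP, htr, Nat.cast_zero]
      exact Matrix.trace_conjTranspose_mul_self_eq_zero_iff.1 h
    simp [hP0]
  · have hc0 : c = 0 := by
      rcases mul_eq_zero.1 hcK with h | h
      · exact h
      · exact absurd h (Nat.cast_ne_zero.2 hKpos.ne')
    rw [pauliString_mul, Matrix.mul_smul, Matrix.smul_mul, hc, hc0, zero_smul, smul_zero]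

/-- **The packing operator** `Q = Σ_{E ∈ ℰ_t} E P E` of a pure `((n,K,d))`, `2t < d`, is idempotent.
[cite: SarvepalliKlappenecker2010, §1 eq. (2) («the standard proof of (2) by a simple counting argument»)] -/
theorem packing_idem {K d t : ℕ} {P : Matrix (ι → Bool) (ι → Bool) ℂ} (hP : IsCodeProjection P K d)
    (hpure : IsPureToWeight P d) (htd : 2 * t < d) :
    (∑ E ∈ ballWords ι t, pauliString E * P * pauliString E) *
        (∑ E ∈ ballWords ι t, pauliString E * P * pauliString E) =
      ∑ E ∈ ballWords ι t, pauliString E * P * pauliString E := by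
  rw [Finset.sum_mul_sum]
  refine Finset.sum_congr rfl fun E hE => ?_
  rw [Finset.sum_eq_single_of_mem E hE]
  · -- diagonal term: `E P E E P E = E P E`
    calc pauliString E * P * pauliString E * (pauliString E * P * pauliString E)
        = pauliString E * P * (pauliString E * pauliString E) * P * pauliString E := by
          simp only [Matrix.mul_assoc]
      _ = pauliString E * P * pauliString E := by
          rw [pauliString_mul_self, Matrix.mul_one, Matrix.mul_assoc (pauliString E) P P, hP.2.1]
  · intro F hF hFE
    have h0 := compress_mul_eq_zero hP hpure htd (mem_ballWords.1 hE) (mem_ballWords.1 hF) (Ne.symm hFE)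
    calc pauliString E * P * pauliString E * (pauliString F * P * pauliString F)
        = pauliString E * (P * (pauliString E * pauliString F) * P) * pauliString F := by
          simp only [Matrix.mul_assoc]
      _ = 0 := by rw [h0, Matrix.mul_zero, Matrix.zero_mul]

/-- The packing operator is Hermitian. [cite: SarvepalliKlappenecker2010, §1 eq. (2)] -/
theorem packing_isHermitian {P : Matrix (ι → Bool) (ι → Bool) ℂ} (hH : P.IsHermitian) (B : Finset (ι → Pauli)) :
    (∑ E ∈ B, pauliString E * P * pauliString E).IsHermitian := by
  change (∑ E ∈ B, pauliString E * P * pauliString E)ᴴ = _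
  rw [Matrix.conjTranspose_sum]
  refine Finset.sum_congr rfl fun E _ => ?_
  rw [Matrix.conjTranspose_mul, Matrix.conjTranspose_mul, conjTranspose_pauliString, hH.eq, Matrix.mul_assoc]

/-- The trace of the packing operator is `K · |ℰ_t|`. [cite: SarvepalliKlappenecker2010, §1 eq. (2)] -/
theorem trace_packing {P : Matrix (ι → Bool) (ι → Bool) ℂ} {K : ℕ} (htr : P.trace = (K : ℂ))
    (B : Finset (ι → Pauli)) : (∑ E ∈ B, pauliString E * P * pauliString E).trace = (#B : ℂ) * K := by
  rw [Matrix.trace_sum]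
  have h : ∀ E ∈ B, (pauliString E * P * pauliString E).trace = (K : ℂ) := fun E _ => by
    rw [Matrix.trace_mul_comm, ← Matrix.mul_assoc, pauliString_mul_self, Matrix.one_mul, htr]
  rw [Finset.sum_congr rfl h, Finset.sum_const, nsmul_eq_mul]

/-- **A Hermitian idempotent has trace at most the dimension**: `Tr Q ≤ 2ⁿ` on `n` qubits, from
`0 ≤ Tr((1−Q)†(1−Q)) = Tr(1) − Tr(Q)`. [folklore] -/
private theorem trace_re_le_card_of_idem {Q : Matrix (ι → Bool) (ι → Bool) ℂ} (hH : Q.IsHermitian)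
    (hQQ : Q * Q = Q) : Q.trace.re ≤ (2 : ℝ) ^ Fintype.card ι := by
  have h1 : ((1 - Q)ᴴ * (1 - Q)) = 1 - Q := by
    rw [Matrix.conjTranspose_sub, Matrix.conjTranspose_one, hH.eq, Matrix.sub_mul, Matrix.one_mul, Matrix.mul_sub,
      Matrix.mul_one, hQQ, sub_self, sub_zero]
  have hpos : 0 ≤ (1 - Q : Matrix (ι → Bool) (ι → Bool) ℂ).trace := by
    rw [← h1]; exact (Matrix.posSemidef_conjTranspose_mul_self _).trace_nonneg
  rw [Matrix.trace_sub, Matrix.trace_one, Fintype.card_fun, Fintype.card_bool] at hpos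
  have h2 := (Complex.nonneg_iff.1 hpos).1
  rw [Complex.sub_re] at h2
  have h3 : ((2 ^ Fintype.card ι : ℕ) : ℂ).re = (2 : ℝ) ^ Fintype.card ι := by
    rw [Complex.natCast_re]; push_cast; ring
  linarith

/-- **Quantum Hamming bound for pure codes, counting form on an arbitrary finite register**: if `P` is the
projection onto a PURE `((n,K,d))` and `2t < d`, then `K · Σ_{j ≤ t} 3^j C(n,j) ≤ 2ⁿ`.
[cite: SarvepalliKlappenecker2010, §1 eq. (2) (q = 2, special case: pure ⇒ nondegenerate)] -/
theorem mul_card_ball_le_of_pure {K d t : ℕ} {P : Matrix (ι → Bool) (ι → Bool) ℂ} (hP : IsCodeProjection P K d)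
    (hpure : IsPureToWeight P d) (htd : 2 * t < d) :
    K * ∑ j ∈ range (t + 1), 3 ^ j * (Fintype.card ι).choose j ≤ 2 ^ Fintype.card ι := by
  have hQ := trace_re_le_card_of_idem (packing_isHermitian hP.1 (ballWords ι t)) (packing_idem hP hpure htd)
  rw [trace_packing hP.2.2.1] at hQ
  rw [← card_ballWords]
  have h : ((#(ballWords ι t) : ℂ) * K).re = (K * #(ballWords ι t) : ℕ) := by
    rw [← Nat.cast_mul, Complex.natCast_re]; push_cast; ring
  rw [h] at hQ
  exact_mod_cast hQ

/-- **The quantum Hamming (sphere-packing) bound for pure quantum codes of arbitrary structure** (additive or not):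
a pure `((n,K,2t+1))` qubit code satisfies `K · Σ_{j=0}^{t} 3^j C(n,j) ≤ 2ⁿ` — «a nondegenerate `((n,K,d))_q`
quantum code satisfies the Hamming bound `K ≤ qⁿ / Σ_{j=0}^{⌊(d−1)/2⌋} C(n,j)(q²−1)^j`», `q = 2`, for the pure
(hence nondegenerate) codes, in the shape of the tree's additive `quantumHammingBound`. Column: proved.
[cite: SarvepalliKlappenecker2010, §1 eq. (2); CalderbankEtAl1998, §7 eq. (14)] -/
theorem quantumHammingBound_pure (n K t : ℕ) (P : Matrix (Fin n → Bool) (Fin n → Bool) ℂ)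
    (hP : IsCodeProjection P K (2 * t + 1)) (hpure : IsPureToWeight P (2 * t + 1)) :
    (∑ j ∈ range (t + 1), 3 ^ j * n.choose j) * K ≤ 2 ^ n := by
  have h := mul_card_ball_le_of_pure hP hpure (Nat.lt_succ_self _)
  rw [Fintype.card_fin] at h
  rwa [mul_comm]

end Literature.InformationTheory.QuantumCodes
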